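import Summits.Ventures.HodgeKum4.Theorems.KummerFixedLocusFixedPointForm
import Literature.AlgebraicGeometry.GroupActions.FixedPointScheme
import HarnessLib

/-!
# I1geo from the fixed-point OBJECT of `⟨ι, g⟩` (cell `hodge-kum4`, seat p2; D1 vocabulary)

HONEST FRAMING.  Nothing here proves I1geo (`Kum4FixedFourfoldMeetsTranslates`, the `@[conjecture]`
residual of route `KummerFixedLocus`) or the Hodge conjecture.  This file restates the
transport-friendly sufficient form of `KummerFixedLocusFixedPointForm`
(`kum4FixedFourfoldMeetsTranslates_of_fixedPointOnW`) in the vocabulary of the tree's fixed-point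
schemes (`Literature.AlgebraicGeometry.GroupActions.IsFixedPointObject`, Conrad–Gabber–Prasad
A.8.10(1), module `GroupActions/FixedPointScheme`, item `defn-FixedPointScheme` = D1 of the cell):
**if, for every Kummer fixed datum `(ι, W, i)` on `X` and every `g ∈ Γ(X) ∖ 1`, a point
`x : Spec ℂ ⟶ X` lying on `W` exhibits `Spec ℂ` as the fixed-point object of the subgroup
`⟨ι, g⟩ ≤ Aut X`, then I1geo holds** (given the printed `|Γ(X)| = 625`).  The hypothesis is exactly
"`X^{⟨ι, g⟩}` is one reduced `ℂ`-point of `W`" — the statement that Oguiso's Prop. 3.6 (finite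
`Fix(g)` at the Kummer point), Cartan's linearisation (CGP A.8.10(2)) and Hassett–Tschinkel's
equivariant families (D2) are meant to deliver.
-/

noncomputable section

open CategoryTheory MonoidalCategory CartesianMonoidalCategory
open Literature.AlgebraicGeometry Literature.AlgebraicGeometry.Hyperkaehler
open Literature.AlgebraicGeometry.GroupActions

namespace Summit.Ventures.HodgeKum4

/-- A generalized point fixed by `ι` and by `g` is fixed by every element of the subgroup they
generate (`(a b).hom = b.hom ≫ a.hom`, `(a⁻¹).hom = a.inv`). -/
theorem comp_hom_eq_of_mem_closure_pair {C : Type*} [Category C] {X T : C} (ι g : Aut X)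
    (y : T ⟶ X) (hyι : y ≫ ι.hom = y) (hyg : y ≫ g.hom = y) :
    ∀ a ∈ Subgroup.closure ({ι, g} : Set (Aut X)), y ≫ a.hom = y := by
  intro a ha
  induction ha using Subgroup.closure_induction with
  | mem a ha =>
    rcases ha with rfl | ha
    · exact hyι
    · rw [Set.mem_singleton_iff.mp ha]
      exact hyg
  | one => exact Category.comp_id y
  | mul a b _ _ iha ihb =>
    show y ≫ (b.hom ≫ a.hom) = y
    rw [← Category.assoc, ihb, iha]
  | inv a _ iha =>
    show y ≫ a.inv = y
    calc y ≫ a.inv = (y ≫ a.hom) ≫ a.inv := by rw [iha]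
      _ = y := by rw [Category.assoc, Iso.hom_inv_id, Category.comp_id]

/-- **I1geo from the fixed-point object of `⟨ι, g⟩`** (D1 vocabulary).  If for every smooth
projective `X` of `Kum⁴`-type, every Kummer fixed datum `(ι, W, i)` and every `g ∈ Γ(X) ∖ 1` there is
a point `x : Spec ℂ ⟶ X` on `W` (`x = p ≫ i`) with
`IsFixedPointObject (Subgroup.closure {ι, g}).subtype x` — `Spec ℂ` IS the fixed-point scheme
`X^{⟨ι, g⟩}` — then `Kum4FixedFourfoldMeetsTranslates` (given the printed `|Γ(X)| = 625`). -/
theorem kum4FixedFourfoldMeetsTranslates_of_isFixedPointObject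
    (hcard : Floccari2026_card_autFixingH2H3_kum4Type)
    (h : ∀ ⦃X : Motives.SchemeOver ℂ⦄, Motives.IsSmoothProjective 8 X → IsOfGeneralizedKummerType 4 X →
      ∀ (ι : Aut X) ⦃W : Motives.SchemeOver ℂ⦄ (i : W ⟶ X), IsKummerFixedDatum X ι W i →
        ∀ g : autFixingH2H3 X, g ≠ 1 →
          ∃ x : 𝟙_ (Motives.SchemeOver ℂ) ⟶ X,
            IsFixedPointObject (Subgroup.closure ({ι, g.val} : Set (Aut X))).subtype x ∧
            ∃ p : 𝟙_ (Motives.SchemeOver ℂ) ⟶ W, p ≫ i = x) :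
    Kum4FixedFourfoldMeetsTranslates := by
  refine kum4FixedFourfoldMeetsTranslates_of_fixedPointOnW hcard fun X hX hK ι W i hd g hg => ?_
  obtain ⟨x, hx, p, hp⟩ := h hX hK ι i hd g hg
  refine ⟨x, ⟨p, hp⟩, ?_, fun T y hyι hyg => ?_⟩
  · -- `x` is fixed by `g ∈ ⟨ι, g⟩`
    exact hx.comp_hom ⟨g.val, Subgroup.subset_closure (by simp)⟩
  · -- universality: an `ι`- and `g`-fixed `T`-point is `⟨ι, g⟩`-fixed, hence factors through `x`
    have hy : ∀ a : Subgroup.closure ({ι, g.val} : Set (Aut X)),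
        y ≫ ((Subgroup.closure ({ι, g.val} : Set (Aut X))).subtype a).hom = y :=
      fun a => comp_hom_eq_of_mem_closure_pair ι g.val y hyι hyg a.val a.property
    obtain ⟨t, ht, -⟩ := hx.existsUnique_fac y hy
    rw [← ht, toUnit_unique t (toUnit T)]

/-- **Fixed-point-SCHEME form** (with the closed-immersion clause, `IsFixedPointScheme`): the same
conclusion from the stronger predicate. -/
theorem kum4FixedFourfoldMeetsTranslates_of_isFixedPointScheme
    (hcard : Floccari2026_card_autFixingH2H3_kum4Type)
    (h : ∀ ⦃X : Motives.SchemeOver ℂ⦄, Motives.IsSmoothProjective 8 X → IsOfGeneralizedKummerType 4 X →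
      ∀ (ι : Aut X) ⦃W : Motives.SchemeOver ℂ⦄ (i : W ⟶ X), IsKummerFixedDatum X ι W i →
        ∀ g : autFixingH2H3 X, g ≠ 1 →
          ∃ x : 𝟙_ (Motives.SchemeOver ℂ) ⟶ X,
            IsFixedPointScheme (Subgroup.closure ({ι, g.val} : Set (Aut X))).subtype x ∧
            ∃ p : 𝟙_ (Motives.SchemeOver ℂ) ⟶ W, p ≫ i = x) :
    Kum4FixedFourfoldMeetsTranslates :=
  kum4FixedFourfoldMeetsTranslates_of_isFixedPointObject hcard fun X hX hK ι W i hd g hg => by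
    obtain ⟨x, hx, p, hp⟩ := h hX hK ι i hd g hg
    exact ⟨x, hx.toIsFixedPointObject, p, hp⟩

end Summit.Ventures.HodgeKum4

end
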